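import Literature.NumberTheory.DiophantineGeometry.AbcDepthCensusCRT

/-!
# A certified census of abc triples by 5-depth in boxes `c ≤ N` — the fast checker

Third layer over `AbcDepthCensus.lean` / `AbcDepthCensusCRT.lean`, with the same soundness statement
and two efficiency changes that matter once a cell has millions of depth patterns (e.g. `ω₅ ≥ 7` in
the box `10¹⁴`: `1 584 156` patterns, `1.8·10⁷` outer steps):

* `patternsAcc` — the pattern generator in accumulator-passing style (no list appends) with `N³`
  precomputed; `mem_patternsAcc` identifies its output with that of `patterns` (as a set);
* `loopCRTe` — the Chinese-remainder walk of `loopCRT` with the unit `e ≡ (0, 1) (mod M₁, M₂)`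
  computed ONCE per pattern, the residue of the second member being `e·s mod M₁M₂`
  (`mod_mul_eq_unit_mul`); falls back to `loopBest` when moduli are not coprime, so `loopCRTe_sound`
  is unconditional;
* `sound_of_forall_patterns` — the exhaustiveness argument of `checkCell_sound` stated once for an
  arbitrary sound per-pattern walk; `checkCellFast_sound`, `depth_lt_of_checkCellFast`,
  `depth_lt_of_checkCellFast_gcd`, `hits_complete_of_checkCellFast` follow.

No axiom beyond `propext`, `Classical.choice`, `Quot.sound`; compiled evaluations live with the consumers
(`Summits/ABC/ABC/Theorems/IneffectiveSubspaceDeepRegimeABCCensus*.lean`).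
-/

namespace Literature.NumberTheory.DiophantineGeometry.DepthCensus

/-! ## The accumulator-style generator -/

/-- `patternsAcc N3 N ps k A B C acc`: the patterns of `patterns N ps k A B C` (with the pruning bound
`N3`, meant to be `N³`) consed onto `acc`, without list appends. [folklore] -/
def patternsAcc (N3 N : ℕ) : List ℕ → ℕ → ℕ → ℕ → ℕ → List (ℕ × ℕ × ℕ) → List (ℕ × ℕ × ℕ)
  | _, 0, A, B, C, acc => (A, B, C) :: acc
  | [], _ + 1, _, _, _, acc => acc
  | p :: ps, k + 1, A, B, C, acc =>
      if N3 < 4 * (A * B * C) * p ^ (5 * (k + 1)) then acc else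
        let acc₁ := if C * p ^ 5 ≤ N then patternsAcc N3 N ps k A B (C * p ^ 5) acc else acc
        let acc₂ := if B * p ^ 5 ≤ N then patternsAcc N3 N ps k A (B * p ^ 5) C acc₁ else acc₁
        let acc₃ := if A * p ^ 5 ≤ N then patternsAcc N3 N ps k (A * p ^ 5) B C acc₂ else acc₂
        patternsAcc N3 N ps (k + 1) A B C acc₃

/-- `patternsAcc (N³)` lists exactly the patterns of `patterns`, plus the accumulator. [folklore] -/
theorem mem_patternsAcc (N : ℕ) (x : ℕ × ℕ × ℕ) : ∀ (ps : List ℕ) (k A B C : ℕ)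
    (acc : List (ℕ × ℕ × ℕ)),
    x ∈ patternsAcc (N ^ 3) N ps k A B C acc ↔ x ∈ patterns N ps k A B C ∨ x ∈ acc := by
  intro ps
  induction ps with
  | nil =>
    intro k A B C acc
    cases k <;> simp [patternsAcc, patterns]
  | cons p ps ih =>
    intro k A B C acc
    cases k with
    | zero => simp [patternsAcc, patterns]
    | succ k =>
      simp only [patternsAcc, patterns]
      by_cases h0 : N ^ 3 < 4 * (A * B * C) * p ^ (5 * (k + 1))
      · simp [h0]
      · simp only [if_neg h0, ih, List.mem_append]
        by_cases hA : A * p ^ 5 ≤ N <;> by_cases hB : B * p ^ 5 ≤ N <;> by_cases hC : C * p ^ 5 ≤ N <;>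
          simp only [hA, hB, hC, if_true, if_false, ih, List.not_mem_nil, or_false] <;> tauto

/-! ## The CRT walk with a precomputed unit -/

/-- If `e ≡ 0 (mod M₁)`, `e ≡ 1 (mod M₂)`, `M₁ ∣ x` and `x ≡ s (mod M₂)`, then
`x % (M₁M₂) = e·s % (M₁M₂)`. [folklore] -/
theorem mod_mul_eq_unit_mul {M₁ M₂ x s e : ℕ} (co : Nat.Coprime M₁ M₂) (he1 : e ≡ 0 [MOD M₁])
    (he2 : e ≡ 1 [MOD M₂]) (h1 : M₁ ∣ x) (h2 : x ≡ s [MOD M₂]) :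
    x % (M₁ * M₂) = e * s % (M₁ * M₂) := by
  have hx1 : x ≡ e * s [MOD M₁] := by
    have h0 : e * s ≡ 0 * s [MOD M₁] := he1.mul_right s
    rw [zero_mul] at h0
    exact (Nat.modEq_zero_iff_dvd.mpr h1).trans h0.symm
  have hx2 : x ≡ e * s [MOD M₂] := by
    have h0 : e * s ≡ 1 * s [MOD M₂] := he2.mul_right s
    rw [one_mul] at h0
    exact h2.trans h0.symm
  exact (Nat.modEq_and_modEq_iff_modEq_mul co).mp ⟨hx1, hx2⟩

/-- The unit `e = CRT(0,1) % (M₁M₂)` has the two residues `0 (mod M₁)`, `1 (mod M₂)`. [folklore] -/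
theorem crtUnit_spec {M₁ M₂ : ℕ} (co : Nat.Coprime M₁ M₂) :
    (Nat.chineseRemainder co 0 1 : ℕ) % (M₁ * M₂) ≡ 0 [MOD M₁] ∧
      (Nat.chineseRemainder co 0 1 : ℕ) % (M₁ * M₂) ≡ 1 [MOD M₂] := by
  set k := Nat.chineseRemainder co 0 1
  have hmod : (k : ℕ) % (M₁ * M₂) ≡ k [MOD M₁ * M₂] := Nat.mod_modEq _ _
  exact ⟨(hmod.of_mul_right M₂).trans k.2.1, (hmod.of_mul_left M₁).trans k.2.2⟩

/-- **The CRT lattice walk with the unit hoisted out of the loop** (same enumeration as `loopCRT`).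
[folklore] -/
def loopCRTe (N A B C : ℕ) (test : ℕ → ℕ → ℕ → Bool) : Bool :=
  if hAB : Nat.Coprime A B then
    if hBC : Nat.Coprime B C then
      if hAC : Nat.Coprime A C then
        if A ≤ C ∧ B ≤ C then
          -- iterate `c = C·k`; `a ≡ 0 (A)`, `a ≡ c (B)`; `0 < a ≤ c - 1`
          let L := A * B
          let e := (Nat.chineseRemainder hAB 0 1 : ℕ) % L
          allRange (fun k => allPosRes (e * (C * k % B) % L) L (C * k - 1)
            (fun a => test a (C * k - a) (C * k))) 1 (N / C) true
        else if B ≤ A ∧ C ≤ A then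
          -- iterate `a = A·i`; `b ≡ 0 (B)`, `b ≡ -a (C)`; `0 < b ≤ N - a`
          let L := B * C
          let e := (Nat.chineseRemainder hBC 0 1 : ℕ) % L
          allRange (fun i => allPosRes (e * ((C - A * i % C) % C) % L) L (N - A * i)
            (fun b => test (A * i) b (A * i + b))) 1 (N / A) true
        else
          -- iterate `b = B·j`; `a ≡ 0 (A)`, `a ≡ -b (C)`; `0 < a ≤ N - b`
          let L := A * C
          let e := (Nat.chineseRemainder hAC 0 1 : ℕ) % L
          allRange (fun j => allPosRes (e * ((C - B * j % C) % C) % L) L (N - B * j)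
            (fun a => test a (B * j) (a + B * j))) 1 (N / B) true
      else loopBest N A B C test
    else loopBest N A B C test
  else loopBest N A B C test

/-- `loopCRTe` visits every solution. [folklore] -/
theorem loopCRTe_sound {N A B C : ℕ} {test : ℕ → ℕ → ℕ → Bool} (hA : 0 < A) (hB : 0 < B)
    (hC : 0 < C) (h : loopCRTe N A B C test = true) {a b c : ℕ} (ha : A ∣ a) (hb : B ∣ b)
    (hc : C ∣ c) (ha0 : 0 < a) (hb0 : 0 < b) (habc : a + b = c) (hcN : c ≤ N) :
    test a b c = true := by
  unfold loopCRTe at h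
  by_cases hAB : Nat.Coprime A B
  · rw [dif_pos hAB] at h
    by_cases hBC : Nat.Coprime B C
    · rw [dif_pos hBC] at h
      by_cases hAC : Nat.Coprime A C
      · rw [dif_pos hAC] at h
        split_ifs at h with h₁ h₂
        · -- iterate `c`
          obtain ⟨k, rfl⟩ := hc
          simp only at h
          rw [allRange_eq_true_iff] at h
          have hk : 1 ≤ k := Nat.pos_of_ne_zero (by rintro rfl; simp at habc; omega)
          have hkN : k < 1 + N / C := by
            have : k ≤ N / C := (Nat.le_div_iff_mul_le hC).mpr (by nlinarith)
            omega
          have hin := h.2 k hk hkN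
          obtain ⟨he1, he2⟩ := crtUnit_spec hAB
          have hres : a % (A * B) =
              (Nat.chineseRemainder hAB 0 1 : ℕ) % (A * B) * (C * k % B) % (A * B) := by
            refine mod_mul_eq_unit_mul hAB he1 he2 ha ?_
            -- `a ≡ c (mod B)` since `B ∣ b = c - a`
            obtain ⟨j, rfl⟩ := hb
            have hck : C * k = a + B * j := habc.symm
            have : a % B = C * k % B := by rw [hck, Nat.add_mul_mod_self_left]
            show a % B = C * k % B % B
            rw [Nat.mod_mod]; exact this
          have hf := allPosRes_spec (Nat.mul_pos hA hB) hin hres ha0 (by omega)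
          have hb' : b = C * k - a := by omega
          subst hb'
          simpa using hf
        · -- iterate `a`
          obtain ⟨i, rfl⟩ := ha
          simp only at h
          rw [allRange_eq_true_iff] at h
          have hi : 1 ≤ i := Nat.pos_of_ne_zero (by rintro rfl; simp at ha0)
          have hiN : i < 1 + N / A := by
            have : i ≤ N / A := (Nat.le_div_iff_mul_le hA).mpr (by nlinarith)
            omega
          have hin := h.2 i hi hiN
          obtain ⟨he1, he2⟩ := crtUnit_spec hBC
          have hres : b % (B * C) =
              (Nat.chineseRemainder hBC 0 1 : ℕ) % (B * C) * ((C - A * i % C) % C) % (B * C) := by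
            refine mod_mul_eq_unit_mul hBC he1 he2 hb ?_
            have : b % C = (C - A * i % C) % C := mod_eq_neg_mod hC (habc ▸ hc)
            show b % C = (C - A * i % C) % C % C
            rw [Nat.mod_mod]; exact this
          have hf := allPosRes_spec (Nat.mul_pos hB hC) hin hres hb0 (by omega)
          subst habc
          simpa using hf
        · -- iterate `b`
          obtain ⟨j, rfl⟩ := hb
          simp only at h
          rw [allRange_eq_true_iff] at h
          have hj : 1 ≤ j := Nat.pos_of_ne_zero (by rintro rfl; simp at hb0)
          have hjN : j < 1 + N / B := by
            have : j ≤ N / B := (Nat.le_div_iff_mul_le hB).mpr (by nlinarith)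
            omega
          have hin := h.2 j hj hjN
          obtain ⟨he1, he2⟩ := crtUnit_spec hAC
          have hres : a % (A * C) =
              (Nat.chineseRemainder hAC 0 1 : ℕ) % (A * C) * ((C - B * j % C) % C) % (A * C) := by
            refine mod_mul_eq_unit_mul hAC he1 he2 ha ?_
            have : a % C = (C - B * j % C) % C :=
              mod_eq_neg_mod hC (by rw [add_comm]; exact habc ▸ hc)
            show a % C = (C - B * j % C) % C % C
            rw [Nat.mod_mod]; exact this
          have hf := allPosRes_spec (Nat.mul_pos hA hC) hin hres ha0 (by omega)
          subst habc
          simpa using hf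
      · rw [dif_neg hAC] at h
        exact loopBest_sound hA hB hC h ha hb hc ha0 hb0 habc hcN
    · rw [dif_neg hBC] at h
      exact loopBest_sound hA hB hC h ha hb hc ha0 hb0 habc hcN
  · rw [dif_neg hAB] at h
    exact loopBest_sound hA hB hC h ha hb hc ha0 hb0 habc hcN

/-! ## Exhaustiveness, once and for all -/

/-- **The exhaustiveness argument of `checkCell_sound` for an arbitrary sound per-pattern walk**:
if `loop` visits every solution of every pattern and accepts every pattern of
`patterns N (deepPrimes N R) K 1 1 1` (`N < (R+1)⁵`), then `test` holds on every abc triple with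
`c ≤ N` and `ω₅(abc) ≥ K`. [folklore] -/
theorem sound_of_forall_patterns {N R K : ℕ} {test : ℕ → ℕ → ℕ → Bool}
    {loop : ℕ → ℕ → ℕ → ℕ → (ℕ → ℕ → ℕ → Bool) → Bool}
    (hloop : ∀ {A B C : ℕ}, 0 < A → 0 < B → 0 < C → loop N A B C test = true →
      ∀ {a b c : ℕ}, A ∣ a → B ∣ b → C ∣ c → 0 < a → 0 < b → a + b = c → c ≤ N → test a b c = true)
    (hR : N < (R + 1) ^ 5)
    (h : ∀ t ∈ patterns N (deepPrimes N R) K 1 1 1, loop N t.1 t.2.1 t.2.2 test = true)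
    {a b c : ℕ} (habc : IsABCTriple a b c) (hcN : c ≤ N)
    (hK : K ≤ ((a * b * c).primeFactors.filter (fun p => 5 ≤ (a * b * c).factorization p)).card) :
    test a b c = true := by
  obtain ⟨ha, hb, hsum, hcop⟩ := habc
  have hc : 0 < c := by omega
  have habc0 : a * b * c ≠ 0 := by positivity
  obtain ⟨S, hSsub, hScard⟩ := Finset.exists_subset_card_eq hK
  have hS : ∀ p ∈ S, p.Prime ∧ p ^ 5 ∣ a * b * c := by
    intro p hp
    have hp' := hSsub hp
    rw [Finset.mem_filter, Nat.mem_primeFactors] at hp'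
    exact ⟨hp'.1.1, (hp'.1.1.pow_dvd_iff_le_factorization habc0).mpr hp'.2⟩
  set τ : ℕ → Fin 3 := fun p => if p ^ 5 ∣ a then 0 else if p ^ 5 ∣ b then 1 else 2 with hτ
  set T : List ℕ := (deepPrimes N R).filter (· ∈ S) with hT
  have hTsub : T.Sublist (deepPrimes N R) := List.filter_sublist
  have hmemT : ∀ p, p ∈ T ↔ p ∈ S := by
    intro p
    simp only [hT, List.mem_filter, decide_eq_true_eq, mem_deepPrimes]
    constructor
    · exact fun h => h.2
    · intro hp
      obtain ⟨hpr, hdvd⟩ := hS p hp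
      have hp5 : p ^ 5 ≤ N := by
        rcases pow_dvd_or ⟨ha, hb, hsum, hcop⟩ hpr hdvd with h | h | h
        · exact (Nat.le_of_dvd ha h).trans (by omega)
        · exact (Nat.le_of_dvd hb h).trans (by omega)
        · exact (Nat.le_of_dvd hc h).trans hcN
      refine ⟨⟨?_, hpr, hp5⟩, hp⟩
      by_contra hlt
      have : (R + 1) ^ 5 ≤ p ^ 5 := Nat.pow_le_pow_left (by omega) 5
      omega
  have hTnd : T.Nodup := (deepPrimes_nodup N R).filter _
  have hTpr : ∀ p ∈ T, p.Prime := fun p hp => (hS p ((hmemT p).mp hp)).1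
  have hTlen : T.length = K := by
    rw [← List.toFinset_card_of_nodup hTnd, ← hScard]
    congr 1
    ext p
    rw [List.mem_toFinset, hmemT]
  have hτa : ∀ p, τ p = 0 → p ^ 5 ∣ a := by
    intro p hp
    by_contra hn
    simp only [hτ, hn, if_false] at hp
    split_ifs at hp <;> exact absurd hp (by decide)
  have hτb : ∀ p, τ p = 1 → p ^ 5 ∣ b := by
    intro p hp
    by_contra hn
    simp only [hτ, hn, if_false] at hp
    split_ifs at hp <;> exact absurd hp (by decide)
  have hτc : ∀ p ∈ T, τ p = 2 → p ^ 5 ∣ c := by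
    intro p hpT hp
    obtain ⟨hpr, hdvd⟩ := hS p ((hmemT p).mp hpT)
    rcases pow_dvd_or ⟨ha, hb, hsum, hcop⟩ hpr hdvd with h | h | h
    · simp [hτ, h] at hp
    · have hna : ¬ p ^ 5 ∣ a := by
        intro h'
        simp [hτ, h'] at hp
      simp [hτ, hna, h] at hp
    · exact h
  have hA : asgProd τ 0 T ∣ a := asgProd_dvd hTnd hTpr (fun p _ hp => hτa p hp)
  have hB : asgProd τ 1 T ∣ b := asgProd_dvd hTnd hTpr (fun p _ hp => hτb p hp)
  have hC : asgProd τ 2 T ∣ c := asgProd_dvd hTnd hTpr hτc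
  have hAle : 1 * asgProd τ 0 T ≤ N := by
    rw [one_mul]; exact (Nat.le_of_dvd ha hA).trans (by omega)
  have hBle : 1 * asgProd τ 1 T ≤ N := by
    rw [one_mul]; exact (Nat.le_of_dvd hb hB).trans (by omega)
  have hCle : 1 * asgProd τ 2 T ≤ N := by
    rw [one_mul]; exact (Nat.le_of_dvd hc hC).trans hcN
  have hABC : 4 * ((1 * asgProd τ 0 T) * (1 * asgProd τ 1 T) * (1 * asgProd τ 2 T)) ≤ N ^ 3 := by
    simp only [one_mul]
    calc 4 * (asgProd τ 0 T * asgProd τ 1 T * asgProd τ 2 T) ≤ 4 * (a * b * c) :=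
          Nat.mul_le_mul_left 4 (Nat.mul_le_mul (Nat.mul_le_mul (Nat.le_of_dvd ha hA)
            (Nat.le_of_dvd hb hB)) (Nat.le_of_dvd hc hC))
      _ ≤ N ^ 3 := four_mul_le_cube hsum hcN
  have hmem := mem_patterns N (deepPrimes N R) K 1 1 1 T τ hTsub hTlen (deepPrimes_sorted N R)
    (fun p hp => (mem_deepPrimes.mp hp).2.1.one_le) hAle hBle hCle hABC
  have hrun := h _ hmem
  simp only at hrun
  have h1 : ∀ d, 0 < 1 * asgProd τ d T := fun d => by
    rw [one_mul]
    exact one_le_asgProd τ d (fun p hp => (hTpr p hp).one_le)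
  have hA' : 1 * asgProd τ 0 T ∣ a := by rwa [one_mul]
  have hB' : 1 * asgProd τ 1 T ∣ b := by rwa [one_mul]
  have hC' : 1 * asgProd τ 2 T ∣ c := by rwa [one_mul]
  exact hloop (h1 0) (h1 1) (h1 2) hrun hA' hB' hC' ha hb hsum hcN

/-! ## The fast cell checker -/

/-- **The fast cell checker**: accumulator-style patterns, hoisted-unit CRT walk. [folklore] -/
def checkCellFast (N R K : ℕ) (test : ℕ → ℕ → ℕ → Bool) : Bool :=
  (patternsAcc (N ^ 3) N (deepPrimes N R) K 1 1 1 []).all (fun t => loopCRTe N t.1 t.2.1 t.2.2 test)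

/-- **Soundness of `checkCellFast`.** If `N < (R+1)⁵` and the checker accepts, then `test` holds on every
abc triple with `c ≤ N` and `ω₅(abc) ≥ K`. [folklore] -/
theorem checkCellFast_sound {N R K : ℕ} {test : ℕ → ℕ → ℕ → Bool} (hR : N < (R + 1) ^ 5)
    (h : checkCellFast N R K test = true) {a b c : ℕ} (habc : IsABCTriple a b c) (hcN : c ≤ N)
    (hK : K ≤ ((a * b * c).primeFactors.filter (fun p => 5 ≤ (a * b * c).factorization p)).card) :
    test a b c = true := by
  rw [checkCellFast, List.all_eq_true] at h
  refine sound_of_forall_patterns (loop := loopCRTe)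
    (fun hA hB hC hl _ _ _ ha hb hc ha0 hb0 hs hN => loopCRTe_sound hA hB hC hl ha hb hc ha0 hb0 hs hN)
    hR (fun t ht => h t ?_) habc hcN hK
  exact (mem_patternsAcc N t _ K 1 1 1 []).mpr (Or.inl ht)

/-- **Empty cells (fast).** [folklore] -/
theorem depth_lt_of_checkCellFast {N R K : ℕ} (hR : N < (R + 1) ^ 5)
    (h : checkCellFast N R K (fun _ _ _ => false) = true) {a b c : ℕ} (habc : IsABCTriple a b c)
    (hcN : c ≤ N) :
    ((a * b * c).primeFactors.filter (fun p => 5 ≤ (a * b * c).factorization p)).card < K := by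
  by_contra hK
  exact Bool.false_ne_true (checkCellFast_sound hR h habc hcN (not_lt.mp hK))

/-- **No abc triple in the cell-in-the-box (fast)**, from the test "`gcd(a,b) ≠ 1`". [folklore] -/
theorem depth_lt_of_checkCellFast_gcd {N R K : ℕ} (hR : N < (R + 1) ^ 5)
    (h : checkCellFast N R K (fun a b _ => !(Nat.gcd a b == 1)) = true) {a b c : ℕ}
    (habc : IsABCTriple a b c) (hcN : c ≤ N) :
    ((a * b * c).primeFactors.filter (fun p => 5 ≤ (a * b * c).factorization p)).card < K := by
  by_contra hK
  have hrun := checkCellFast_sound hR h habc hcN (not_lt.mp hK)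
  have hcop : Nat.gcd a b = 1 := habc.2.2.2
  simp [hcop] at hrun

/-- **Census (fast).** If the checker accepts `hitTest L`, every abc hit of the cell `{ω₅ ≥ K}` in the
box `{c ≤ N}` is listed in `L` with its radical, in one of the two orientations. [folklore] -/
theorem hits_complete_of_checkCellFast {N R K : ℕ} {L : List (ℕ × ℕ × ℕ × ℕ)}
    (hR : N < (R + 1) ^ 5) (h : checkCellFast N R K (hitTest L) = true) {a b c : ℕ}
    (habc : IsABCTriple a b c) (hcN : c ≤ N)
    (hK : K ≤ ((a * b * c).primeFactors.filter (fun p => 5 ≤ (a * b * c).factorization p)).card)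
    (hlt : rad a b c < c) : (a, b, c, rad a b c) ∈ L ∨ (b, a, c, rad a b c) ∈ L :=
  hitTest_sound habc (checkCellFast_sound hR h habc hcN hK) hlt

end Literature.NumberTheory.DiophantineGeometry.DepthCensus
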